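import Literature.IUT.HodgeTheaters.ProfiniteCompletionBasisCharacters
import Literature.IUT.HodgeTheaters.ProfiniteCompletionExtension
import Literature.IUT.HodgeTheaters.SurfaceGroupBridge
import Literature.GroupTheory.CombinatorialGroupTheory.SurfaceGroupConjugacySeparable
import Literature.GroupTheory.CombinatorialGroupTheory.SurfaceGroupHeisenbergLift
import Mathlib.LinearAlgebra.Dual.Lemmas
import Mathlib.Algebra.Field.ZMod
import Mathlib.LinearAlgebra.Dimension.Constructions
import Mathlib.LinearAlgebra.FiniteDimensional.Lemmas
import HarnessLib

/-!
# [IUTchI] Lemma 2.7 (v), ORIENTABLE-SURFACE-GROUP HALF, modulo two classical facts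

Mochizuki, *Inter-universal Teichmüller theory I*, kurims manuscript (May 2020), §2, Lemma 2.7 (v)
(statement p. 57, proof p. 59) [cite: Mochizuki2012, Lem 2.7(v) p.59] (D-0012 claim key, status disputed
— plain profinite group theory, no side taken).  `ProfiniteCompletionBasisCharacters.lean`
(abc-iut-L5-t17) reduced the named statement `FreeOrSurface.zHatQuotientNormallyTerminal` to the
finite-level residual NO BASIS CHARACTER for orientable surface groups: no open `U ⊆ Ŝ_g` carries a
continuous `ψ : U → (ℤ/p)²` sending a COMMUTING pair `τ, κ` to a basis.  This file proves that residual
— and hence Lemma 2.7 (v) for free AND orientable surface groups, AS TYPED — MODULO exactly two classical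
inputs on the discrete surface groups `S_g = ⟨a₁, b₁, …, a_g, b_g ∣ ∏ [aᵢ, bᵢ]⟩`
(`Literature.Topology.FourManifolds.SurfaceGroup`):

* (F_cov) `SurfaceGroupFiniteIndexSubgroup` (the tree's NAMED FACT, abc-iut-L5-d2,
  `SurfaceGroupConjugacySeparable.lean`; Zieschang–Vogt–Coldewey Thm 4.14.22 / Prop 4.14.23): a
  subgroup of index `j` of `S_g`, `g ≥ 2`, is a surface group `S_h`, `h = j (g - 1) + 1`;
* (F_res) the one irreducibly cohomological input of the printed proof ("the `l`-cohomological
  dimension of `T̂₁` is `1`", p. 59), in explicit-cocycle dress, taken here as the INLINE HYPOTHESIS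
  `hR` (not a cited fact): restriction to a subgroup `K ⊆ S_g` of finite index, transported along ANY
  isomorphism `K ≅ S_h`, multiplies the Heisenberg obstruction
  `ω_g(Φ) = ∑ᵢ (Φ₁(aᵢ)Φ₂(bᵢ) - Φ₂(aᵢ)Φ₁(bᵢ))` of a pair of characters `Φ : S_g → 𝔽_p × 𝔽_p` by
  `± [S_g : K]` — classically: an `n`-sheeted cover of closed oriented surfaces has degree `± n` on `H²`
  (K. S. Brown, *Cohomology of Groups*, III (9.5)(ii) `cor ∘ res = index` with the `PD²` fundamental
  classes; Hatcher, *Algebraic Topology*, §3.3).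

Route (`noBasisCharacter_of_surfaceFacts`), replacing the `cd_l`-argument of p. 59: `H = η⁻¹(U) ≅ S_h`
(F_cov); the mod-`p` abelianisation `S_h ↠ 𝔽_p^{2h}` extends continuously to `Π̂ : U → 𝔽_p^{2h}`
(`exists_extension`, part V); since `2h ≥ 4 > 2` some nonzero linear form `λ` kills `Π̂ τ, Π̂ κ`
(`exists_dual_ne_zero_vanishing_pair`); `U' = Ker(λ ∘ Π̂) ∋ τ, κ` is open and `η⁻¹(U')` has index `p` in
`H`; by F_cov again `η⁻¹(U') ≅ S_{h'}`, and by F_res the obstruction of `ψ` transported to `S_{h'}` is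
`± p · ω = 0`; so it lifts to the extraspecial group of order `p³` (`exists_extraspecial_lift`,
`SurfaceGroupHeisenbergLift.lean`), the lift extends to `U'` (`exists_extension_lift`), and the commuting
`τ, κ` would have commuting lifts of `(1,0), (0,1)` — impossible (`false_of_lift_pair`).

Main results: `noBasisCharacter_of_surfaceFacts` and
`FreeOrSurface.zHatQuotientNormallyTerminal_of_surfaceFacts (hF) (hR) : zHatQuotientNormallyTerminal`
— the named statement of Lemma 2.7 (v) DISCHARGED MODULO {F_cov, F_res}.  Typed ≠ discharged beyond
that: both inputs remain hypotheses.  Theorems only.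
-/

namespace Literature.IUT.HodgeTheaters

open CategoryTheory ProfiniteGrp ProfiniteGrp.ProfiniteCompletion Topology Multiplicative
open Literature.GroupTheory.CombinatorialGroupTheory

universe u

namespace ProfiniteCompletion

/-! ### Linear algebra: a nonzero linear form killing two given vectors -/

/-- In a finite-dimensional vector space of dimension `> 2` over a field, any two vectors are killed by
a common NONZERO linear form (the span of two vectors is a proper subspace); used with `𝔽_p^{2h}`,
`h ≥ 2` (p. 59: "`T̂₁` is of infinite index in `Ĝ` … there exists an open subgroup `Ĝ₁ ⊆ Ĝ` … and a
continuous surjection `φ : Ĝ₁ ↠ ℤ_l` whose kernel contains `T̂₁`", finite level). [cite: Mochizuki2012, Lem 2.7(v) p.59] -/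
theorem exists_dual_ne_zero_vanishing_pair {K : Type*} [Field K] {W : Type*} [AddCommGroup W]
    [Module K W] [FiniteDimensional K W] (hW : 2 < Module.finrank K W) (v w : W) :
    ∃ f : W →ₗ[K] K, f ≠ 0 ∧ f v = 0 ∧ f w = 0 := by
  classical
  let S : Submodule K W := Submodule.span K (({v, w} : Finset W) : Set W)
  have hS : S < ⊤ := by
    rw [lt_top_iff_ne_top]
    intro htop
    have h1 : Module.finrank K S ≤ ({v, w} : Finset W).card := finrank_span_finset_le_card _
    have h2 : ({v, w} : Finset W).card ≤ 2 := Finset.card_insert_le _ _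
    rw [htop, finrank_top] at h1
    omega
  obtain ⟨f, hf, hfS⟩ := Submodule.exists_dual_map_eq_bot_of_lt_top hS inferInstance
  have hle : S ≤ LinearMap.ker f := LinearMap.le_ker_iff_map.mpr hfS
  have hv : v ∈ S := Submodule.subset_span (by simp)
  have hw : w ∈ S := Submodule.subset_span (by simp)
  exact ⟨f, hf, hle hv, hle hw⟩

/-! ### Orientable surface groups have no basis character, modulo F_cov and F_res -/

variable {G : Type u} [Group G]

/-- **NO BASIS CHARACTER for orientable surface groups, modulo F_cov and F_res** (see the module
docstring for the route and for the two hypotheses; `hR` quantifies over all genera, primes, finite-index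
subgroups `K ⊆ S_g` with an isomorphism `K ≅ S_h`, and pairs of characters `Φ`, and asserts
`ω_h(Φ|_K) = ± [S_g : K] · ω_g(Φ)` with the Heisenberg obstruction `ω` written out).  Conclusion: the
inline statement consumed by `centralizer_le_of_zHat_of_noBasisCharacter` /
`FreeOrSurface.zHatQuotientNormallyTerminal_of_surface_noBasisCharacter`. [cite: Mochizuki2012, Lem 2.7(v) p.59] -/
theorem noBasisCharacter_of_surfaceFacts (hF : SurfaceGroupFiniteIndexSubgroup)
    (hR : ∀ (g h p : ℕ) (K : Subgroup (Literature.Topology.FourManifolds.SurfaceGroup g)),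
      K.FiniteIndex → ∀ (e : K ≃* Literature.Topology.FourManifolds.SurfaceGroup h)
      (Φ : Literature.Topology.FourManifolds.SurfaceGroup g →*
        Multiplicative (ZMod p) × Multiplicative (ZMod p)),
      (∑ i : Fin h,
        ((toAdd ((Φ.comp (K.subtype.comp e.symm.toMonoidHom))
            (Literature.Topology.FourManifolds.SurfaceGroup.a i)).1) *
          (toAdd ((Φ.comp (K.subtype.comp e.symm.toMonoidHom))
            (Literature.Topology.FourManifolds.SurfaceGroup.b i)).2) -
         (toAdd ((Φ.comp (K.subtype.comp e.symm.toMonoidHom))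
            (Literature.Topology.FourManifolds.SurfaceGroup.a i)).2) *
          (toAdd ((Φ.comp (K.subtype.comp e.symm.toMonoidHom))
            (Literature.Topology.FourManifolds.SurfaceGroup.b i)).1))) =
        (K.index : ZMod p) * (∑ i : Fin g,
          ((toAdd (Φ (Literature.Topology.FourManifolds.SurfaceGroup.a i)).1) *
            (toAdd (Φ (Literature.Topology.FourManifolds.SurfaceGroup.b i)).2) -
           (toAdd (Φ (Literature.Topology.FourManifolds.SurfaceGroup.a i)).2) *
            (toAdd (Φ (Literature.Topology.FourManifolds.SurfaceGroup.b i)).1))) ∨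
      (∑ i : Fin h,
        ((toAdd ((Φ.comp (K.subtype.comp e.symm.toMonoidHom))
            (Literature.Topology.FourManifolds.SurfaceGroup.a i)).1) *
          (toAdd ((Φ.comp (K.subtype.comp e.symm.toMonoidHom))
            (Literature.Topology.FourManifolds.SurfaceGroup.b i)).2) -
         (toAdd ((Φ.comp (K.subtype.comp e.symm.toMonoidHom))
            (Literature.Topology.FourManifolds.SurfaceGroup.a i)).2) *
          (toAdd ((Φ.comp (K.subtype.comp e.symm.toMonoidHom))
            (Literature.Topology.FourManifolds.SurfaceGroup.b i)).1))) =
        -((K.index : ZMod p) * (∑ i : Fin g,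
          ((toAdd (Φ (Literature.Topology.FourManifolds.SurfaceGroup.a i)).1) *
            (toAdd (Φ (Literature.Topology.FourManifolds.SurfaceGroup.b i)).2) -
           (toAdd (Φ (Literature.Topology.FourManifolds.SurfaceGroup.a i)).2) *
            (toAdd (Φ (Literature.Topology.FourManifolds.SurfaceGroup.b i)).1)))))
    (hG : IsOrientableSurfaceGroup G) :
    ∀ (p : ℕ), p.Prime → ∀ (U : Subgroup (profiniteCompletion G)),
      (∃ N₁ : FiniteIndexNormalSubgroup G, ∀ x : profiniteCompletion G, x.val N₁ = 1 → x ∈ U) →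
      ∀ (ψ : U →* Multiplicative (ZMod p) × Multiplicative (ZMod p)),
      (∃ N₂ : FiniteIndexNormalSubgroup G,
        ∀ (x : profiniteCompletion G) (hx : x ∈ U), x.val N₂ = 1 → ψ ⟨x, hx⟩ = 1) →
      ∀ (τ κ : profiniteCompletion G) (hτ : τ ∈ U) (hκ : κ ∈ U), τ * κ = κ * τ →
      ψ ⟨τ, hτ⟩ = (ofAdd 1, 1) → ψ ⟨κ, hκ⟩ = (1, ofAdd 1) → False := by
  classical
  intro p hp U hU1 ψ hψ1 τ κ hτ hκ hc hψτ hψκ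
  haveI : Fact p.Prime := ⟨hp⟩
  haveI : NeZero p := ⟨hp.ne_zero⟩
  obtain ⟨N₁, hN₁⟩ := hU1
  obtain ⟨N₂, hN₂⟩ := hψ1
  -- (1) `G ≅ S_g` in the `FourManifolds` presentation
  obtain ⟨g, hg2, ⟨e₁⟩⟩ := hG
  obtain ⟨bridge⟩ := exists_mulEquiv_surfaceGroup g
  let e₀ : G ≃* Literature.Topology.FourManifolds.SurfaceGroup g := e₁.trans bridge
  -- (2) the discrete subgroup `H = η⁻¹(U)`, of finite index, and `H ≅ S_h` by F_cov
  let H : Subgroup G := U.comap (toCompletion G)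
  haveI hHfi : H.FiniteIndex := by
    apply Subgroup.finiteIndex_of_le (H := N₁.toSubgroup)
    intro t ht
    change toCompletion G t ∈ U
    apply hN₁
    change (QuotientGroup.mk t : G ⧸ N₁.toSubgroup) = 1
    rw [QuotientGroup.eq_one_iff]
    exact ht
  let K₀ : Subgroup (Literature.Topology.FourManifolds.SurfaceGroup g) :=
    H.map (e₀ : G →* Literature.Topology.FourManifolds.SurfaceGroup g)
  have hK₀idx : K₀.index = H.index := Subgroup.index_map_equiv H e₀
  have hK₀fi : K₀.FiniteIndex := ⟨by rw [hK₀idx]; exact hHfi.index_ne_zero⟩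
  obtain ⟨h, hh, ⟨e₂⟩⟩ := hF g hg2 K₀ hK₀fi
  have hh2 : 2 ≤ h := two_le_genus_of_index hg2 hK₀fi.index_ne_zero hh
  let eH : H ≃* Literature.Topology.FourManifolds.SurfaceGroup h := (e₀.subgroupMap H).trans e₂
  -- the inclusion `ι : H → U`
  let ι : H →* U := ((toCompletion G).comp H.subtype).codRestrict U fun t => t.property
  -- (3) the mod-`p` abelianisation `π : S_h ↠ 𝔽_p^{2h}` and its continuous extension `Pih : U → 𝔽_p^{2h}`
  obtain ⟨π, hπsurj, -⟩ :=
    Literature.GroupTheory.CombinatorialGroupTheory.SurfaceGroup.exists_abelianizationModP h p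
  obtain ⟨Pih, Nπ, hNπle, hPih⟩ := exists_extension N₁ hN₁ (π.comp eH.toMonoidHom)
  have hPihι : ∀ t : H, Pih (ι t) = π (eH t) := fun t => hPih _ (ι t).2 t t.2 rfl
  -- (4) a nonzero linear form `lam` on `𝔽_p^{2h}` killing `Pih τ` and `Pih κ` (`2h ≥ 4 > 2`)
  have hdim : 2 < Module.finrank (ZMod p) (Literature.Topology.FourManifolds.surfaceGen h → ZMod p) := by
    rw [Module.finrank_fintype_fun_eq_card, Fintype.card_prod, Fintype.card_fin, Fintype.card_bool]
    omega
  obtain ⟨lam, hlam0, hlamτ, hlamκ⟩ :=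
    exists_dual_ne_zero_vanishing_pair (K := ZMod p)
      (W := Literature.Topology.FourManifolds.surfaceGen h → ZMod p) hdim
      (toAdd (Pih ⟨τ, hτ⟩)) (toAdd (Pih ⟨κ, hκ⟩))
  let χ : U →* Multiplicative (ZMod p) := (lam.toAddMonoidHom.toMultiplicative).comp Pih
  have hχ : ∀ x : U, χ x = ofAdd (lam (toAdd (Pih x))) := fun x => rfl
  -- (5) the open subgroup `U' = Ker χ ∋ τ, κ`
  let U' : Subgroup (profiniteCompletion G) := χ.ker.map U.subtype
  have hU'le : U' ≤ U := Subgroup.map_subtype_le _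
  have hmemU' : ∀ (x : profiniteCompletion G) (hx : x ∈ U), χ ⟨x, hx⟩ = 1 → x ∈ U' :=
    fun x hx h1 => ⟨⟨x, hx⟩, h1, rfl⟩
  have hU'mem : ∀ (x : profiniteCompletion G) (hx' : x ∈ U'), χ ⟨x, hU'le hx'⟩ = 1 := by
    rintro x ⟨y, hy, rfl⟩
    exact hy
  have hτ' : τ ∈ U' := hmemU' τ hτ (by rw [hχ, hlamτ, ofAdd_zero])
  have hκ' : κ ∈ U' := hmemU' κ hκ (by rw [hχ, hlamκ, ofAdd_zero])
  have hU'1 : ∃ N : FiniteIndexNormalSubgroup G, ∀ x : profiniteCompletion G, x.val N = 1 → x ∈ U' := by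
    refine ⟨Nπ, fun x hx => ?_⟩
    have hxU : x ∈ U := hN₁ x (val_eq_one_of_le x hNπle hx)
    refine hmemU' x hxU ?_
    have h1 : Pih ⟨x, hxU⟩ = 1 := by
      have := hPih x hxU 1 H.one_mem hx
      rw [this, show (⟨1, H.one_mem⟩ : H) = 1 from rfl, map_one]
    rw [hχ, h1, toAdd_one, map_zero, ofAdd_zero]
  let ψ' : U' →* Multiplicative (ZMod p) × Multiplicative (ZMod p) := ψ.comp (Subgroup.inclusion hU'le)
  have hψ'1 : ∃ N : FiniteIndexNormalSubgroup G,
      ∀ (x : profiniteCompletion G) (hx : x ∈ U'), x.val N = 1 → ψ' ⟨x, hx⟩ = 1 :=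
    ⟨N₂, fun x hx hxN => hN₂ x (hU'le hx) hxN⟩
  -- (6) the discrete side of `U'`: `χH = χ ∘ ι`, nontrivial, hence of index `p`
  let χH : H →* Multiplicative (ZMod p) := χ.comp ι
  have hχHne : χH.range ≠ ⊥ := by
    obtain ⟨w, hw⟩ : ∃ w, lam w ≠ 0 := by
      by_contra hall
      push Not at hall
      exact hlam0 (LinearMap.ext hall)
    obtain ⟨s, hs⟩ := hπsurj (ofAdd w)
    obtain ⟨t, rfl⟩ := eH.surjective s
    intro hbot
    have ht : χH t ∈ χH.range := ⟨t, rfl⟩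
    rw [hbot, Subgroup.mem_bot] at ht
    change χ (ι t) = 1 at ht
    rw [hχ, hPihι, hs, toAdd_ofAdd, ofAdd_eq_one] at ht
    exact hw ht
  have hχHidx : χH.ker.index = p := by
    haveI : Fact (Nat.card (Multiplicative (ZMod p))).Prime :=
      ⟨by rw [show Nat.card (Multiplicative (ZMod p)) = Nat.card (ZMod p) from rfl, Nat.card_zmod]
          exact hp⟩
    rw [Subgroup.index_ker, (χH.range.eq_bot_or_eq_top_of_prime_card).resolve_left hχHne,
      Subgroup.card_top]
    exact Nat.card_zmod p
  -- the subgroup `K ⊆ S_h` corresponding to `η⁻¹(U')`, of index `p`, and `K ≅ S_{h'}` by F_cov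
  let K : Subgroup (Literature.Topology.FourManifolds.SurfaceGroup h) :=
    χH.ker.map (eH : H →* Literature.Topology.FourManifolds.SurfaceGroup h)
  have hKidx : K.index = p := by rw [Subgroup.index_map_equiv χH.ker eH, hχHidx]
  have hKfi : K.FiniteIndex := ⟨by rw [hKidx]; exact hp.ne_zero⟩
  obtain ⟨h', -, ⟨e₃⟩⟩ := hF h hh2 K hKfi
  -- `Φ = ψ ∘ η ∘ eH⁻¹ : S_h → 𝔽_p²` and its transport `Φ'` to `K ≅ S_{h'}`
  let Φ : Literature.Topology.FourManifolds.SurfaceGroup h →*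
      Multiplicative (ZMod p) × Multiplicative (ZMod p) := (ψ.comp ι).comp eH.symm.toMonoidHom
  let Φ' : Literature.Topology.FourManifolds.SurfaceGroup h' →*
      Multiplicative (ZMod p) × Multiplicative (ZMod p) := Φ.comp (K.subtype.comp e₃.symm.toMonoidHom)
  -- F_res: the Heisenberg obstruction of `Φ'` is `± p · ω(Φ) = 0`
  have hω' : (∑ i : Fin h',
      ((toAdd (Φ' (Literature.Topology.FourManifolds.SurfaceGroup.a i)).1) *
        (toAdd (Φ' (Literature.Topology.FourManifolds.SurfaceGroup.b i)).2) -
       (toAdd (Φ' (Literature.Topology.FourManifolds.SurfaceGroup.a i)).2) *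
        (toAdd (Φ' (Literature.Topology.FourManifolds.SurfaceGroup.b i)).1))) = 0 := by
    rcases hR h h' p K hKfi e₃ Φ with hpos | hneg
    · rw [hpos, hKidx, ZMod.natCast_self, zero_mul]
    · rw [hneg, hKidx, ZMod.natCast_self, zero_mul, neg_zero]
  -- (7) lift `Φ'` to the extraspecial group, transport to `η⁻¹(U')`, extend to `U'`
  obtain ⟨E, _, _, α, hE, hlift⟩ :=
    Literature.GroupTheory.CombinatorialGroupTheory.exists_extraspecial_lift p
  obtain ⟨θS, hθS⟩ := hlift h' Φ' hω'
  -- the discrete subgroup `η⁻¹(U')` and its map to `K`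
  have hH'U : ∀ t : U'.comap (toCompletion G), (t : G) ∈ H := fun t => hU'le t.2
  have hH'ker : ∀ t : U'.comap (toCompletion G), (⟨t, hH'U t⟩ : H) ∈ χH.ker := by
    intro t
    rw [MonoidHom.mem_ker]
    have := hU'mem (toCompletion G t) t.2
    exact this
  let j : U'.comap (toCompletion G) →* K :=
    MonoidHom.mk' (fun t => ⟨eH ⟨t, hH'U t⟩, ⟨⟨t, hH'U t⟩, hH'ker t, rfl⟩⟩) fun s t => by
      apply Subtype.ext
      change eH ⟨(s : G) * t, _⟩ = eH ⟨s, hH'U s⟩ * eH ⟨t, hH'U t⟩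
      rw [← map_mul]
      rfl
  let θ₀ : U'.comap (toCompletion G) →* E := θS.comp (e₃.toMonoidHom.comp j)
  have hθ₀ : ∀ t : U'.comap (toCompletion G), α (θ₀ t) = ψ' ⟨toCompletion G t, t.2⟩ := by
    intro t
    change α (θS (e₃ (j t))) = ψ ⟨toCompletion G t, hU'le t.2⟩
    rw [hθS]
    change ψ (ι (eH.symm ((K.subtype) (e₃.symm (e₃ (j t)))))) = _
    rw [MulEquiv.symm_apply_apply]
    change ψ (ι (eH.symm (eH ⟨t, hH'U t⟩))) = _
    rw [MulEquiv.symm_apply_apply]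
    rfl
  obtain ⟨θ', hθ'⟩ := exists_extension_lift U' hU'1 α ψ' hψ'1 θ₀ hθ₀
  -- (8) contradiction: `τ, κ` commute but lift `(1,0)`, `(0,1)`
  have hψ'τ : ψ' ⟨τ, hτ'⟩ = (ofAdd 1, 1) := by
    change ψ ⟨τ, hU'le hτ'⟩ = _
    exact hψτ
  have hψ'κ : ψ' ⟨κ, hκ'⟩ = (1, ofAdd 1) := by
    change ψ ⟨κ, hU'le hκ'⟩ = _
    exact hψκ
  exact false_of_lift_pair hτ' hκ' hc ψ' hψ'τ hψ'κ α hE θ' hθ'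

end ProfiniteCompletion

/-! ### Lemma 2.7 (v), as typed, modulo F_cov and F_res -/

namespace FreeOrSurface

/-- **Lemma 2.7 (v)** — the named statement `FreeOrSurface.zHatQuotientNormallyTerminal` for `G`
free of finite rank OR an orientable surface group: a closed `T̂ ⊆ Ĝ` on which a continuous surjection
`Ĝ ↠ ℤ̂` is bijective is normally terminal — DISCHARGED MODULO the two classical inputs F_cov (the
tree's named fact `SurfaceGroupFiniteIndexSubgroup`) and F_res (inline hypothesis `hR`: restriction to a
finite-index subgroup multiplies the Heisenberg obstruction by `±` the index).  The free half is
unconditional (`zHatQuotientNormallyTerminal_of_isFreeOfFiniteRank`).  CONDITIONAL theorem; typed ≠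
discharged for the two inputs. [cite: Mochizuki2012, Lem 2.7(v) p.59] -/
theorem zHatQuotientNormallyTerminal_of_surfaceFacts (hF : SurfaceGroupFiniteIndexSubgroup)
    (hR : ∀ (g h p : ℕ) (K : Subgroup (Literature.Topology.FourManifolds.SurfaceGroup g)),
      K.FiniteIndex → ∀ (e : K ≃* Literature.Topology.FourManifolds.SurfaceGroup h)
      (Φ : Literature.Topology.FourManifolds.SurfaceGroup g →*
        Multiplicative (ZMod p) × Multiplicative (ZMod p)),
      (∑ i : Fin h,
        ((toAdd ((Φ.comp (K.subtype.comp e.symm.toMonoidHom))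
            (Literature.Topology.FourManifolds.SurfaceGroup.a i)).1) *
          (toAdd ((Φ.comp (K.subtype.comp e.symm.toMonoidHom))
            (Literature.Topology.FourManifolds.SurfaceGroup.b i)).2) -
         (toAdd ((Φ.comp (K.subtype.comp e.symm.toMonoidHom))
            (Literature.Topology.FourManifolds.SurfaceGroup.a i)).2) *
          (toAdd ((Φ.comp (K.subtype.comp e.symm.toMonoidHom))
            (Literature.Topology.FourManifolds.SurfaceGroup.b i)).1))) =
        (K.index : ZMod p) * (∑ i : Fin g,
          ((toAdd (Φ (Literature.Topology.FourManifolds.SurfaceGroup.a i)).1) *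
            (toAdd (Φ (Literature.Topology.FourManifolds.SurfaceGroup.b i)).2) -
           (toAdd (Φ (Literature.Topology.FourManifolds.SurfaceGroup.a i)).2) *
            (toAdd (Φ (Literature.Topology.FourManifolds.SurfaceGroup.b i)).1))) ∨
      (∑ i : Fin h,
        ((toAdd ((Φ.comp (K.subtype.comp e.symm.toMonoidHom))
            (Literature.Topology.FourManifolds.SurfaceGroup.a i)).1) *
          (toAdd ((Φ.comp (K.subtype.comp e.symm.toMonoidHom))
            (Literature.Topology.FourManifolds.SurfaceGroup.b i)).2) -
         (toAdd ((Φ.comp (K.subtype.comp e.symm.toMonoidHom))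
            (Literature.Topology.FourManifolds.SurfaceGroup.a i)).2) *
          (toAdd ((Φ.comp (K.subtype.comp e.symm.toMonoidHom))
            (Literature.Topology.FourManifolds.SurfaceGroup.b i)).1))) =
        -((K.index : ZMod p) * (∑ i : Fin g,
          ((toAdd (Φ (Literature.Topology.FourManifolds.SurfaceGroup.a i)).1) *
            (toAdd (Φ (Literature.Topology.FourManifolds.SurfaceGroup.b i)).2) -
           (toAdd (Φ (Literature.Topology.FourManifolds.SurfaceGroup.a i)).2) *
            (toAdd (Φ (Literature.Topology.FourManifolds.SurfaceGroup.b i)).1))))) :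
    zHatQuotientNormallyTerminal.{u} :=
  zHatQuotientNormallyTerminal_of_surface_noBasisCharacter fun _ _ hG =>
    ProfiniteCompletion.noBasisCharacter_of_surfaceFacts hF hR hG

end FreeOrSurface

end Literature.IUT.HodgeTheaters
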